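import Literature.Algebra.Polynomial.CasasAlvero.Transfer
import Literature.Algebra.Polynomial.CasasAlvero.Ascent
import Literature.Algebra.Polynomial.CasasAlvero.Degree6
import Literature.Algebra.Polynomial.CasasAlvero.CharSeventyOneComplete
import Literature.Algebra.Polynomial.CasasAlvero.CharEightyThreeComplete
import HarnessLib

/-!
# Casas-Alvero in characteristic `0`: the GvBLSW transfer in its published form; degrees `5·p^k`, `6·p^k`

`Transfer.lean` proves the transfer principle [GvBLSW 2007, Prop. 2] (`holdsInDegree_of_charP_of_charZero`: CA_d over every
field of characteristic `p` ⟹ CA_d over every field of characteristic `0`) and the theorem of [GvBLSW 2007] (`p^k`, `2p^k`).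
Combined with the GOOD-PRIME results of this directory for degrees `5` (`Degree5.lean`: the bad primes of degree `5` are exactly
`2, 3, 7, 11, 131, 193, 599, 3541, 8009`) and `6` (`Degree6.lean`, `CharSeventyOneComplete.lean`, `CharEightyThreeComplete.lean`:
`17, 31, 41, 43, 53, 59, 71, 83` are good primes of degree `6`), it gives the characteristic-`0` cases `d = 5·p^k` and
`d = 6·p^k` of [CLO 2014, Thm. 4 / §3] ("if `p` is a good prime for degree `n`, CA holds in characteristic `0` in every
degree `n·p^k`"), entirely inside Lean (no computer-algebra certificate is trusted: the degree-`5`/`6` eliminations are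
checked by `linear_combination` in `Degree5*.lean` / `Degree6.lean`).

With the ascent of `Ascent.lean` (Nullstellensatz) the transfer takes exactly its published form
(`holdsInDegree_of_charZero_of_isAlgClosed_charP`): **no Casas-Alvero polynomial of degree `d` over ONE algebraically
closed field of characteristic `p` ⟹ CA in degree `d` over every field of characteristic `0`** [GvBLSW 2007, Prop. 2],
and [CLO 2014, Thm. 3]'s formulation of the GvBLSW theorem (`holdsInDegree_mul_prime_pow_of_charZero_of_isAlgClosed_charP`:
… ⟹ CA in every degree `d·p^j` in characteristic `0`).
-/

noncomputable section

open Polynomial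

namespace Literature.Algebra.Polynomial.CasasAlvero

universe u

section PublishedForm

universe v

/-- **[GvBLSW 2007, Prop. 2] in its published form.**  If there is no Casas-Alvero polynomial of degree `d` over some
algebraically closed field `k` of characteristic `p` (`X_d(𝔽̄_p) = ∅`), then the Casas-Alvero conjecture holds in
degree `d` over every field of characteristic `0`. [cite: GrafVonBothmerEtAl2007, Prop. 2] -/
theorem holdsInDegree_of_charZero_of_isAlgClosed_charP (p : ℕ) [Fact p.Prime] {k : Type v} [Field k]
    [IsAlgClosed k] [CharP k p] {d : ℕ} (h : HoldsInDegree k d) (K : Type u) [Field K] [CharZero K] :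
    HoldsInDegree K d :=
  holdsInDegree_of_charP_of_charZero p (fun F _ _ => holdsInDegree_of_isAlgClosed_charP p h F) K

/-- **The GvBLSW theorem as stated in [CLO 2014, Thm. 3].**  If no Casas-Alvero polynomial of degree `d` exists over
an algebraically closed field of characteristic `p`, then the conjecture holds in characteristic `0` in every degree
`d·p^j`, `j ≥ 0`. [cite: CastryckLaterveerOunaies2012, Thm. 3] [cite: GrafVonBothmerEtAl2007, Prop. 6] -/
theorem holdsInDegree_mul_prime_pow_of_charZero_of_isAlgClosed_charP (p : ℕ) [Fact p.Prime] {k : Type v} [Field k]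
    [IsAlgClosed k] [CharP k p] {d : ℕ} (h : HoldsInDegree k d) (j : ℕ) (K : Type u) [Field K] [CharZero K] :
    HoldsInDegree K (d * p ^ j) :=
  holdsInDegree_of_charP_of_charZero p
    (fun F _ _ => holdsInDegree_mul_prime_pow_field F p (holdsInDegree_of_isAlgClosed_charP p h (AlgebraicClosure F)) j) K

/-- Contrapositive, the "bad prime" dictum of [CLO 2014, (introduction).7]: a counterexample to the conjecture in
characteristic `0` and degree `d` makes EVERY prime bad for degree `d` (a Casas-Alvero polynomial of degree `d` that
is not a pure power exists over every algebraically closed field of every prime characteristic).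
[cite: GrafVonBothmerEtAl2007, Prop. 2] -/
theorem not_holdsInDegree_isAlgClosed_charP_of_charZero {K : Type u} [Field K] [CharZero K] {d : ℕ}
    (hK : ¬ HoldsInDegree K d) (p : ℕ) [Fact p.Prime] (k : Type v) [Field k] [IsAlgClosed k] [CharP k p] :
    ¬ HoldsInDegree k d :=
  fun h => hK (holdsInDegree_of_charZero_of_isAlgClosed_charP p h K)

end PublishedForm

variable (K : Type u) [Field K] [CharZero K]

/-- **Degree `5·p^k` in characteristic `0`** for every prime `p ∉ {2, 3, 7, 11, 131, 193, 599, 3541, 8009}` (the good primes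
of degree `5`). [cite: CastryckLaterveerOunaies2012, Thm. 4] -/
theorem holdsInDegree_five_mul_prime_pow_of_charZero (p : ℕ) [Fact p.Prime] (hp2 : p ≠ 2) (hp3 : p ≠ 3) (hp7 : p ≠ 7)
    (hp11 : p ≠ 11) (hp131 : p ≠ 131) (hp193 : p ≠ 193) (hp599 : p ≠ 599) (hp3541 : p ≠ 3541) (hp8009 : p ≠ 8009)
    (k : ℕ) : HoldsInDegree K (5 * p ^ k) :=
  holdsInDegree_of_charP_of_charZero p
    (fun F _ _ => holdsInDegree_five_mul_prime_pow_field F p hp2 hp3 hp7 hp11 hp131 hp193 hp599 hp3541 hp8009 k) K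

/-- **Degree `6·p^k` in characteristic `0`** for the eight good primes `p ∈ {17, 31, 41, 43, 53, 59, 71, 83}` of degree `6`
verified in this directory (CLO, Thm. 4 and Table 1, list the `53` bad primes of degree `6`; we assert only primes whose
goodness is a Lean theorem here). [cite: CastryckLaterveerOunaies2012, Thm. 4] -/
theorem holdsInDegree_six_mul_prime_pow_of_charZero (p : ℕ)
    (hp : p = 17 ∨ p = 31 ∨ p = 41 ∨ p = 43 ∨ p = 53 ∨ p = 59 ∨ p = 71 ∨ p = 83) (k : ℕ) :
    HoldsInDegree K (6 * p ^ k) := by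
  rcases hp with rfl | rfl | rfl | rfl | rfl | rfl | rfl | rfl
  · haveI : Fact (Nat.Prime 17) := ⟨by norm_num⟩
    exact holdsInDegree_of_charP_of_charZero 17 (fun F _ _ => holdsInDegree_six_mul_pow_of_char_17 F k) K
  · haveI : Fact (Nat.Prime 31) := ⟨by norm_num⟩
    exact holdsInDegree_of_charP_of_charZero 31 (fun F _ _ => holdsInDegree_six_mul_pow_of_char_31 F k) K
  · haveI : Fact (Nat.Prime 41) := ⟨by norm_num⟩
    exact holdsInDegree_of_charP_of_charZero 41 (fun F _ _ => holdsInDegree_six_mul_pow_of_char_41 F k) K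
  · haveI : Fact (Nat.Prime 43) := ⟨by norm_num⟩
    exact holdsInDegree_of_charP_of_charZero 43 (fun F _ _ => holdsInDegree_six_mul_pow_of_char_43 F k) K
  · haveI : Fact (Nat.Prime 53) := ⟨by norm_num⟩
    exact holdsInDegree_of_charP_of_charZero 53 (fun F _ _ => holdsInDegree_six_mul_pow_of_char_53 F k) K
  · haveI : Fact (Nat.Prime 59) := ⟨by norm_num⟩
    exact holdsInDegree_of_charP_of_charZero 59 (fun F _ _ => holdsInDegree_six_mul_pow_of_char_59 F k) K
  · haveI : Fact (Nat.Prime 71) := ⟨by norm_num⟩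
    exact holdsInDegree_of_charP_of_charZero 71 (fun F _ _ => holdsInDegree_six_mul_pow_of_char_71' F k) K
  · haveI : Fact (Nat.Prime 83) := ⟨by norm_num⟩
    exact holdsInDegree_of_charP_of_charZero 83 (fun F _ _ => holdsInDegree_six_mul_pow_of_char_83' F k) K

/-- The smallest new characteristic-`0` degrees this gives beyond `Transfer.lean`: `65 = 5·13`, `85 = 5·17`, `95 = 5·19`,
`102 = 6·17`. [cite: CastryckLaterveerOunaies2012, Thm. 4] -/
theorem holdsInDegree_65_85_95_102_of_charZero :
    HoldsInDegree K 65 ∧ HoldsInDegree K 85 ∧ HoldsInDegree K 95 ∧ HoldsInDegree K 102 := by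
  haveI h13 : Fact (Nat.Prime 13) := ⟨by norm_num⟩
  haveI h17 : Fact (Nat.Prime 17) := ⟨by norm_num⟩
  haveI h19 : Fact (Nat.Prime 19) := ⟨by norm_num⟩
  refine ⟨?_, ?_, ?_, ?_⟩
  · simpa using holdsInDegree_five_mul_prime_pow_of_charZero K 13 (by norm_num) (by norm_num) (by norm_num) (by norm_num)
      (by norm_num) (by norm_num) (by norm_num) (by norm_num) (by norm_num) 1
  · simpa using holdsInDegree_five_mul_prime_pow_of_charZero K 17 (by norm_num) (by norm_num) (by norm_num) (by norm_num)
      (by norm_num) (by norm_num) (by norm_num) (by norm_num) (by norm_num) 1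
  · simpa using holdsInDegree_five_mul_prime_pow_of_charZero K 19 (by norm_num) (by norm_num) (by norm_num) (by norm_num)
      (by norm_num) (by norm_num) (by norm_num) (by norm_num) (by norm_num) 1
  · simpa using holdsInDegree_six_mul_prime_pow_of_charZero K 17 (Or.inl rfl) 1

end Literature.Algebra.Polynomial.CasasAlvero
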